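import Summits.ABC.StewartYu.PadicG3ParNA
import Summits.ABC.StewartYu.PadicG3ParNB
import Summits.ABC.StewartYu.RecordByNameV
import Summits.ABC.StewartYu.RecordOddMono
import HarnessLib

/-!
# The `𝔑`-threaded `p`-adic Gen-3 record `PadicG3ParN` — THE END RECORD BY NAME (`RecordOdd` at the `N`-END slots)

Support file (theorems only; no named facts). Cell `abc-stewartyu`, route `YuMatveevShapeRat`, crux `PadicCoreOddRat`
(stmt-ABC-20503); seat p1 (record owner). The `N`-twin of lp-1's `RecordByNameV.recordOddV` (p496268's family):
the record predicate `GenThreeFrameSpecOdd.RecordOdd (256^·) p n A Amax W D₀ S₀ X_f D` — exits (A), (B), (C) of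
Nesterenko's END — for every END datum of the `N`-frame, `1 ≤ D₀ ≤ D₀N`, `S₀NV ≤ S₀`, `XsV ŜN ≤ 2·X_f + 1`,
`1 ≤ Dⱼ ≤ DN j`, through lp-1's generic `recordOdd_of_facts` with the v2 scalar facts and THREE substitutions:
the END degree scale `ρ₀ := K·N·LV/2^{ŜN}` (`< LgV/2^{n+23}`, `rhoN_lt`), the range scale `T := 2^{Ŝ′N−1}`
(`Ŝ′N = n+24+⌊log₂(KN)⌋`: `2^{n+22}K < T`, `T·⌈g⌉·XV < 2X_f+1`), and `D₀ ≤ D₀N ≤ D₀V`. The convention is the v2 one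
(`N_q = K`, `½ ≤ θ₀`, `Amax ≤ 2ⁿΩ`, `1 ≤ Aⱼ`) and `gⁿ ≤ K` now holds at EVERY `m` (`pow_g_le_K`, `PadicG3ParNB`), so the
END instance `recordOddN_end` needs no branch hypothesis:
`RecordOdd (256^·) p n P.A P.Amax P.W D₀N S₀NV ⌊2ⁿ·XsV ŜN/(2(n+1))⌋ DN` for `p ≥ 3`, `K₀ ≥ p − 1`.

## References
* [Nesterenko2003] Yu. V. Nesterenko, LNM 1819 (2003) — §5.2 (5.5), (5.12)–(5.22), Lemmas 5.3–5.4.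
* [Yu2013] K. Yu, Acta Math. 211 (2013) — §3.1.
-/

noncomputable section

open Finset Real Nat

namespace Summit.ABC.StewartYu

namespace PadicG3ParN

open PadicG3Par (Cb cM cG Cb_pos Cb_le sixtyfour_le_Cb)
open Summit.ABC.StewartYu.RecordExitsNumeric
open Summit.ABC.StewartYu.GenThreeFrameSpecOdd (RecordOdd)

variable {n : ℕ} (P : PadicG3ParN n)

/-! ### The END degree scale `ρ₀ = K·N·LV/2^{ŜN}` and the range at depth `ŜN` -/

/-- `K·N·LV/2^{ŜN} < LgV/2^{n+23}`. [cite: Nesterenko2003, §5.2 (5.17)] -/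
theorem rhoN_lt : (P.K : ℝ) * P.N * P.LV / 2 ^ P.SdN < (P.LgV : ℝ) / 2 ^ (n + 23) := by
  have hS : (2 : ℝ) ^ (n + 23) * (P.K * P.N) * 2 ^ P.lgg < 2 ^ P.SdN := by exact_mod_cast P.lt_two_pow_SdN
  have hKN : (0 : ℝ) < P.K * P.N := mul_pos P.K_pos P.N_pos
  have hL : (0 : ℝ) < P.LgV := by linarith [P.one_le_LgV]
  have hLV : (P.LV : ℝ) ≤ 2 ^ P.lgg * P.LgV :=
    calc (P.LV : ℝ) ≤ P.g * P.LgV := P.LV_le_g_mul_LgV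
      _ ≤ 2 ^ P.lgg * P.LgV := mul_le_mul_of_nonneg_right P.g_le_two_pow_lgg hL.le
  rw [div_lt_div_iff₀ (by positivity) (by positivity)]
  have h1 : ((P.K : ℝ) * P.N) * P.LV * 2 ^ (n + 23) ≤ ((P.K : ℝ) * P.N) * (2 ^ P.lgg * P.LgV) * 2 ^ (n + 23) :=
    mul_le_mul_of_nonneg_right (mul_le_mul_of_nonneg_left hLV hKN.le) (by positivity)
  calc (P.K : ℝ) * P.N * P.LV * 2 ^ (n + 23) = ((P.K : ℝ) * P.N) * P.LV * 2 ^ (n + 23) := by ring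
    _ ≤ ((P.K : ℝ) * P.N) * (2 ^ P.lgg * P.LgV) * 2 ^ (n + 23) := h1
    _ = P.LgV * (2 ^ (n + 23) * (P.K * P.N) * 2 ^ P.lgg) := by ring
    _ < P.LgV * 2 ^ P.SdN := mul_lt_mul_of_pos_left hS hL

/-- `DN j ≤ (K·N·LV/2^{ŜN})/Aⱼ + 1`. [cite: Nesterenko2003, §5.2 (5.5)] -/
theorem DN_le_rhoN_div (j : Fin n) : (P.DN j : ℝ) ≤ (P.K : ℝ) * P.N * P.LV / 2 ^ P.SdN / P.A j + 1 := by
  have hA := P.A_pos j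
  have h0 : 0 ≤ (P.K : ℝ) * P.N * P.LV / (2 ^ P.SdN * P.A j) := by
    have := P.K_pos; have := P.N_pos; positivity
  unfold DN; push_cast
  have h1 := Nat.floor_le h0
  rw [div_div]
  linarith

/-- `n + 24 ≤ Ŝ′N`. [folklore] -/
theorem le_SdepthN : n + 24 ≤ P.SdepthN := by unfold SdepthN; omega

/-- `2^{Ŝ′N−1}·⌈g⌉ ≤ 2^{ŜN−1}`. [folklore] -/
theorem two_pow_SdepthN_pred_mul_gceil_le : 2 ^ (P.SdepthN - 1) * P.gceil ≤ 2 ^ (P.SdN - 1) := by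
  have h1 := P.gceil_le_two_pow_lgg
  have hS := P.le_SdepthN
  have e : P.SdN - 1 = (P.SdepthN - 1) + P.lgg := by rw [P.SdN_eq]; omega
  calc 2 ^ (P.SdepthN - 1) * P.gceil ≤ 2 ^ (P.SdepthN - 1) * 2 ^ P.lgg := Nat.mul_le_mul_left _ h1
    _ = 2 ^ ((P.SdepthN - 1) + P.lgg) := (pow_add 2 _ _).symm
    _ = 2 ^ (P.SdN - 1) := by rw [e]

/-- `2^{n+22}·⌈g⌉ ≤ 2^{ŜN−2}`. [folklore] -/
theorem two_pow_mul_gceil_le_SdN : 2 ^ (n + 22) * P.gceil ≤ 2 ^ (P.SdN - 2) := by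
  have h1 := P.gceil_le_two_pow_lgg
  have hS := P.le_SdepthN
  have e : P.SdN - 2 = (P.SdepthN - 2) + P.lgg := by rw [P.SdN_eq]; omega
  have h2 : 2 ^ (n + 22) ≤ 2 ^ (P.SdepthN - 2) := Nat.pow_le_pow_right (by norm_num) (by omega)
  calc 2 ^ (n + 22) * P.gceil ≤ 2 ^ (P.SdepthN - 2) * 2 ^ P.lgg := Nat.mul_le_mul h2 h1
    _ = 2 ^ ((P.SdepthN - 2) + P.lgg) := (pow_add 2 _ _).symm
    _ = 2 ^ (P.SdN - 2) := by rw [e]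

/-- **`2^{ŜN−1}·XV < XsV ŜN`**. [cite: Nesterenko2003, §5.2 (5.12)] -/
theorem two_pow_mul_XV_lt_XsV_SdN : 2 ^ (P.SdN - 1) * P.XV < P.XsV P.SdN := by
  have h := P.XsV_gt P.SdN
  have hg := P.one_le_g
  have hX : (0 : ℝ) ≤ P.XV := by positivity
  obtain ⟨k, hk⟩ : ∃ k, P.SdN = k + 1 := ⟨P.SdN - 1, by have := P.le_SdepthN; rw [P.SdN_eq]; omega⟩
  rw [hk, Nat.add_sub_cancel]
  rw [hk] at h
  have e : (2 : ℝ) ^ (k + 1) * P.g * P.XV / 2 = 2 ^ k * P.XV * P.g := by rw [pow_succ]; ring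
  rw [e] at h
  have h0 : (0 : ℝ) ≤ 2 ^ k * P.XV := by positivity
  have h1 : (2 : ℝ) ^ k * P.XV ≤ 2 ^ k * P.XV * P.g := le_mul_of_one_le_right h0 hg
  have h3 : (2 : ℝ) ^ k * P.XV < P.XsV (k + 1) := lt_of_le_of_lt h1 h
  exact_mod_cast h3

/-- **The range facts at depth `ŜN`**: if `XsV ŜN ≤ 2·X_f + 1` then `2^{n+22}·(⌈g⌉·XV) ≤ X_f` and
`2^{Ŝ′N−1}·(⌈g⌉·XV) < 2·X_f + 1`. [cite: Nesterenko2003, §5.2 (5.12)] -/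
theorem range_factsN {Xf : ℕ} (hXf : P.XsV P.SdN ≤ 2 * Xf + 1) :
    2 ^ (n + 22) * (P.gceil * P.XV) ≤ Xf ∧ 2 ^ (P.SdepthN - 1) * (P.gceil * P.XV) < 2 * Xf + 1 := by
  have h1 := P.two_pow_mul_XV_lt_XsV_SdN
  have h2 := P.two_pow_SdepthN_pred_mul_gceil_le
  have h3 := P.two_pow_mul_gceil_le_SdN
  have hS : 2 ≤ P.SdN := by have := P.le_SdepthN; rw [P.SdN_eq]; omega
  have e : 2 ^ (P.SdN - 1) = 2 ^ (P.SdN - 2) * 2 := by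
    rw [← pow_succ]; congr 1; omega
  refine ⟨?_, ?_⟩
  · have h4 : 2 ^ (n + 22) * (P.gceil * P.XV) ≤ 2 ^ (P.SdN - 2) * P.XV := by
      rw [← mul_assoc]; exact Nat.mul_le_mul_right _ h3
    have h5 : 2 * (2 ^ (P.SdN - 2) * P.XV) < 2 * Xf + 1 := by
      calc 2 * (2 ^ (P.SdN - 2) * P.XV) = 2 ^ (P.SdN - 2) * 2 * P.XV := by ring
        _ = 2 ^ (P.SdN - 1) * P.XV := by rw [e]
        _ < P.XsV P.SdN := h1
        _ ≤ 2 * Xf + 1 := hXf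
    omega
  · calc 2 ^ (P.SdepthN - 1) * (P.gceil * P.XV) = 2 ^ (P.SdepthN - 1) * P.gceil * P.XV := by ring
      _ ≤ 2 ^ (P.SdN - 1) * P.XV := Nat.mul_le_mul_right _ h2
      _ < P.XsV P.SdN := h1
      _ ≤ 2 * Xf + 1 := hXf

/-- `XsV ŜN ≤ 2·⌊2ⁿ·XsV ŜN/(2(n+1))⌋ + 1` (the frame's END slot). [folklore] -/
theorem XsV_SdN_le_two_mul_add_one : P.XsV P.SdN ≤ 2 * (2 ^ n * P.XsV P.SdN / (2 * (n + 1))) + 1 := by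
  have hn : n + 1 ≤ 2 ^ n := Nat.succ_le_of_lt Nat.lt_two_pow_self
  have h1 : (n + 1) * P.XsV P.SdN ≤ 2 ^ n * P.XsV P.SdN := Nat.mul_le_mul_right _ hn
  have h2 : 2 * (n + 1) * (2 ^ n * P.XsV P.SdN / (2 * (n + 1))) + 2 * (n + 1) > 2 ^ n * P.XsV P.SdN := by
    have := Nat.lt_div_mul_add (a := 2 ^ n * P.XsV P.SdN) (b := 2 * (n + 1)) (by positivity)
    linarith [Nat.div_mul_le_self (2 ^ n * P.XsV P.SdN) (2 * (n + 1))]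
  have h3 : (n + 1) * P.XsV P.SdN < (n + 1) * (2 * (2 ^ n * P.XsV P.SdN / (2 * (n + 1))) + 2) := by
    nlinarith
  have h4 : P.XsV P.SdN < 2 * (2 ^ n * P.XsV P.SdN / (2 * (n + 1))) + 2 := Nat.lt_of_mul_lt_mul_left h3
  omega

/-! ### The record -/

/-- **`RecordOdd (256^·) p n P.A P.Amax P.W D₀ S₀ X_f D` for the `N`-record** at every END datum
`1 ≤ D₀ ≤ D₀N`, `S₀NV ≤ S₀`, `XsV ŜN ≤ 2·X_f + 1`, `1 ≤ Dⱼ ≤ DN j`, under the v2 convention (`N_q = K`, `½ ≤ θ₀`,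
`Amax ≤ 2ⁿΩ`, `1 ≤ Aⱼ`) and `gⁿ ≤ K`. [cite: Nesterenko2003, §5.2 (5.12)–(5.22)] -/
theorem recordOddN (hgK : P.g ^ n ≤ (P.K : ℝ)) (hNq : P.Nq = P.K)
    (hθ : (1 / 2 : ℝ) ≤ P.θ₀) (hAmax : P.Amax ≤ 2 ^ n * P.Ω) (hA1 : ∀ j, 1 ≤ P.A j) (p : ℕ)
    {D₀ S₀ Xf : ℕ} {D : Fin n → ℕ} (hD₀1 : 1 ≤ D₀) (hD₀ : D₀ ≤ P.D0N) (hS₀ : P.S0NV ≤ S₀)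
    (hXf : P.XsV P.SdN ≤ 2 * Xf + 1) (hD1 : ∀ j, 1 ≤ D j) (hD : ∀ j, D j ≤ P.DN j) :
    RecordOdd (fun m => (256 : ℝ) ^ m) p n P.A P.Amax P.W D₀ S₀ Xf D := by
  have hKNq : P.K ≤ P.Nq := hNq.ge
  have hNqK : P.Nq ≤ 2 ^ n * P.K := by rw [hNq]; exact Nat.le_mul_of_pos_left _ (Nat.two_pow_pos n)
  -- positivity / floors (as for the v2 record)
  have hg1 := P.one_le_g
  have hg0 : 0 < P.g := lt_of_lt_of_le one_pos hg1
  have hK1 : (1 : ℝ) ≤ P.K := by exact_mod_cast P.one_le_K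
  have hΩ := P.Ω_pos
  have hΩ1 := P.one_le_Ω hA1
  have hCb64 := sixtyfour_le_Cb
  have hCb0 : (0 : ℝ) ≤ Cb := by linarith
  have hCbn : (1 : ℝ) ≤ Cb ^ n := one_le_pow₀ (by linarith)
  have hL1 := P.one_le_LgV
  have hL0 : (0 : ℝ) ≤ P.LgV := by linarith
  have hXV := P.XV_ge_128
  have hXV0 : (0 : ℝ) ≤ P.XV := by linarith
  have hgceil1 : (1 : ℝ) ≤ P.gceil := by exact_mod_cast P.one_le_gceil
  have hggc := P.g_le_gceil
  have hgn1 : 1 ≤ P.g ^ (n - 1) := one_le_pow₀ hg1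
  have hgnK : P.g ^ (n - 1) ≤ (P.K : ℝ) := (pow_le_pow_right₀ hg1 (Nat.sub_le n 1)).trans hgK
  have hgnpos : 0 < P.g ^ (n - 1) := by positivity
  -- the effective range `X = ⌈g⌉·XV`
  have hXreal : (((P.gceil * P.XV : ℕ) : ℝ)) = (P.gceil : ℝ) * P.XV := by push_cast; ring
  have hXge : (P.XV : ℝ) ≤ ((P.gceil * P.XV : ℕ) : ℝ) := by
    rw [hXreal]; exact le_mul_of_one_le_left hXV0 hgceil1
  have hXgX : P.g * P.XV ≤ ((P.gceil * P.XV : ℕ) : ℝ) := by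
    rw [hXreal]; exact mul_le_mul_of_nonneg_right hggc hXV0
  have hX1 : 1 ≤ P.gceil * P.XV := Nat.mul_pos P.one_le_gceil (le_trans (by omega) P.sixtyfour_le_XV)
  have hX1r : (1 : ℝ) ≤ ((P.gceil * P.XV : ℕ) : ℝ) := by exact_mod_cast hX1
  -- the Siegel constant `c = Cbⁿ/g^{n-1}`
  obtain ⟨c, hc⟩ : ∃ c : ℝ, c = Cb ^ n / P.g ^ (n - 1) := ⟨_, rfl⟩
  have hc0 : 0 ≤ c := by rw [hc]; positivity
  have hcle : c ≤ Cb ^ n := by rw [hc]; exact div_le_self (by positivity) hgn1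
  have hc87 : c ≤ (87 : ℝ) ^ n := hcle.trans (pow_le_pow_left₀ hCb0 Cb_le n)
  have hcΩK : c * P.Ω * P.K = Cb ^ n * P.Ω * P.K / P.g ^ (n - 1) := by rw [hc]; field_simp
  have hcΩK1 : (1 : ℝ) ≤ c * P.Ω * P.K := by
    rw [hcΩK, le_div_iff₀ hgnpos, one_mul]
    have h1 : (1 : ℝ) ≤ Cb ^ n * P.Ω := one_le_mul_of_one_le_of_one_le hCbn hΩ1
    calc P.g ^ (n - 1) ≤ P.K := hgnK
      _ = 1 * P.K := (one_mul _).symm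
      _ ≤ Cb ^ n * P.Ω * P.K := mul_le_mul_of_nonneg_right h1 (by linarith)
  have hXcΩK1 : (1 : ℝ) ≤ ((P.gceil * P.XV : ℕ) : ℝ) * (c * P.Ω * P.K) :=
    one_le_mul_of_one_le_of_one_le hX1r hcΩK1
  -- range facts at depth `ŜN`, `T := 2^{Ŝ′N-1}`
  obtain ⟨hXf1, hXf2⟩ := P.range_factsN hXf
  have hKT : (2 : ℝ) ^ (n + 22) * P.K < ((2 ^ (P.SdepthN - 1) : ℕ) : ℝ) := by
    exact_mod_cast P.two_pow_mul_K_lt_SdepthN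
  have h23 : (2 : ℝ) ^ (n + 23) ≤ ((2 ^ (P.SdepthN - 1) : ℕ) : ℝ) := by
    exact_mod_cast P.two_pow_le_two_pow_SdepthN_pred
  have hxfT : ((2 ^ (P.SdepthN - 1) : ℕ) : ℝ) * ((P.gceil * P.XV : ℕ) : ℝ) < 2 * (Xf : ℝ) + 1 := by
    exact_mod_cast hXf2
  -- the END degree scale `ρ = max ρ₀ 1`, `ρ₀ = K·N·LV/2^{ŜN}`
  obtain ⟨ρ₀, hρ₀⟩ : ∃ ρ₀ : ℝ, ρ₀ = (P.K : ℝ) * P.N * P.LV / 2 ^ P.SdN := ⟨_, rfl⟩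
  have hρ₀lt : ρ₀ < (P.LgV : ℝ) / 2 ^ (n + 23) := by rw [hρ₀]; exact P.rhoN_lt
  have hρ1 : (1 : ℝ) ≤ max ρ₀ 1 := le_max_right _ _
  have hρ₀le : ρ₀ ≤ max ρ₀ 1 := le_max_left _ _
  have hone : (1 : ℝ) < (P.LgV : ℝ) / 2 ^ (n + 23) := by
    have hL : (2 : ℝ) ^ (n + 25) ≤ P.LgV := by exact_mod_cast P.two_pow_le_LgV
    have hlt : (2 : ℝ) ^ (n + 23) < 2 ^ (n + 25) := pow_lt_pow_right₀ (by norm_num) (by omega)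
    rw [lt_div_iff₀ (by positivity), one_mul]
    linarith
  have hρlt : max ρ₀ 1 < (P.LgV : ℝ) / 2 ^ (n + 23) := max_lt hρ₀lt hone
  have hDρ : ∀ j, (D j : ℝ) ≤ max ρ₀ 1 / P.A j + 1 := by
    intro j
    have hA := P.A_pos j
    have h1 : (D j : ℝ) ≤ P.DN j := by exact_mod_cast hD j
    have h2 := P.DN_le_rhoN_div j
    rw [← hρ₀] at h2
    have h3 : ρ₀ / P.A j ≤ max ρ₀ 1 / P.A j := div_le_div_of_nonneg_right hρ₀le hA.le
    linarith
  -- the box of clause (C)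
  have h24 := P.core_Ω_le_LgV hgK
  have hΛL : max ρ₀ 1 + P.Amax ≤ (((2 : ℝ) ^ (n + 23))⁻¹ + 2 ^ n / (24 * Cb ^ n)) * P.LgV := by
    have h1 : max ρ₀ 1 ≤ ((2 : ℝ) ^ (n + 23))⁻¹ * P.LgV := by
      rw [inv_mul_eq_div]; exact hρlt.le
    have h2 : P.Amax ≤ 2 ^ n / (24 * Cb ^ n) * P.LgV := by
      have hCbn0 : (0 : ℝ) < 24 * Cb ^ n := by positivity
      calc P.Amax ≤ 2 ^ n * P.Ω := hAmax
        _ = 2 ^ n / (24 * Cb ^ n) * (24 * Cb ^ n * P.Ω) := by field_simp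
        _ ≤ 2 ^ n / (24 * Cb ^ n) * P.LgV := mul_le_mul_of_nonneg_left h24 (by positivity)
    have e : (((2 : ℝ) ^ (n + 23))⁻¹ + 2 ^ n / (24 * Cb ^ n)) * P.LgV =
        ((2 : ℝ) ^ (n + 23))⁻¹ * P.LgV + 2 ^ n / (24 * Cb ^ n) * P.LgV := by ring
    rw [e]; linarith
  -- `LgV ≤ (264 Cbⁿ + 2^{2n+26}) K Ω`
  have hgK' : P.g ≤ (P.K : ℝ) := by
    have : P.g ≤ P.g ^ n := le_self_pow₀ hg1 (by have := P.hn; omega)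
    linarith
  have hLKΩ : (P.LgV : ℝ) ≤ (264 * Cb ^ n + 2 ^ (2 * n + 26)) * P.K * ∏ j, P.A j :=
    P.LgV_le_KΩ hθ hNqK hAmax hA1 hgK'
  -- exit B scalars
  have hcore0 : 0 < Cb ^ n * P.Ω * P.K := by positivity
  have eΩ : c * (∏ j, P.A j) * P.K = c * P.Ω * P.K := rfl
  have h3L : (3 / 2 : ℝ) * (n + 1) * P.LgV ≤ ((P.gceil * P.XV : ℕ) : ℝ) * (c * (∏ j, P.A j) * P.K) := by
    have hXE := P.XE_le_XV
    rw [div_le_iff₀ hcore0] at hXE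
    rw [eΩ, hcΩK, mul_div_assoc', le_div_iff₀ hgnpos]
    calc (3 / 2 : ℝ) * (n + 1) * P.LgV * P.g ^ (n - 1) ≤ P.XV * (Cb ^ n * P.Ω * P.K) := hXE
      _ ≤ ((P.gceil * P.XV : ℕ) : ℝ) * (Cb ^ n * P.Ω * P.K) := mul_le_mul_of_nonneg_right hXge hcore0.le
  have hD₀V : (D₀ : ℝ) ≤ P.D0V := by exact_mod_cast hD₀.trans P.D0N_le_D0V
  have hD₀8 : (D₀ : ℝ) ≤ 8 * ((P.gceil * P.XV : ℕ) : ℝ) * (c * (∏ j, P.A j) * P.K) := by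
    have h2 : (P.D0V : ℝ) < 6 * P.XV * (Cb ^ n * P.Ω * P.K / P.g ^ (n - 1)) + 2 := by
      have h := P.L0V_lt
      have e : 6 * (P.XV : ℝ) * Cb ^ n * P.Ω * P.K / P.g ^ (n - 1) =
          6 * P.XV * (Cb ^ n * P.Ω * P.K / P.g ^ (n - 1)) := by field_simp
      unfold PadicG3Par.D0V; push_cast; linarith
    rw [eΩ]
    rw [← hcΩK] at h2
    have hq : 0 ≤ c * P.Ω * P.K := by linarith
    have h5 : (P.XV : ℝ) * (c * P.Ω * P.K) ≤ ((P.gceil * P.XV : ℕ) : ℝ) * (c * P.Ω * P.K) :=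
      mul_le_mul_of_nonneg_right hXge hq
    linarith [hXcΩK1, h5, hD₀V, h2]
  have hD₀q : (D₀ : ℝ) ≤ ((P.gceil * P.XV : ℕ) : ℝ) * P.LgV / 4 + 2 := by
    have h2 := P.D0V_le'
    have h3 : P.g * P.XV * P.LgV ≤ ((P.gceil * P.XV : ℕ) : ℝ) * P.LgV :=
      mul_le_mul_of_nonneg_right hXgX hL0
    linarith
  have hS : 16 * (n + 1) * P.LgV < (S₀ + 1) * (n + 2) ^ 4 :=
    lt_of_lt_of_le P.MV_lt_S0NV_succ_mul (Nat.mul_le_mul_right _ (by omega))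
  have hL24 : 2 ^ (n + 24) ≤ P.LgV :=
    le_trans (Nat.pow_le_pow_right (by norm_num) (by omega)) P.two_pow_le_LgV
  exact recordOdd_of_facts P.hn hA1 P.hAmax P.hAmax1 P.hW p (PadicG3Par.pow256_admissible n).1
    (PadicG3Par.pow256_admissible n).2 hX1 hL24 hD₀1 hD₀q hXf1 hS hD1 hDρ hρ1 hρlt hK1 hc0 hc87 h3L hD₀8
    h23 hxfT hKT hΛL hLKΩ

/-- **THE `N`-RECORD AT THE FRAME'S END SLOTS** (`p ≥ 3`, `K₀ ≥ p − 1`, `N_q = K`, `½ ≤ θ₀`, `Amax ≤ 2ⁿΩ`, `1 ≤ Aⱼ`;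
no branch hypothesis — `gⁿ ≤ K` at every `m`):
`RecordOdd (256^·) p n P.A P.Amax P.W D₀N S₀NV ⌊2ⁿ·XsV ŜN/(2(n+1))⌋ DN`. [cite: Nesterenko2003, §5.2 (5.12)–(5.22)] -/
theorem recordOddN_end (hp3 : 3 ≤ P.p) (hK₀ : (P.p : ℝ) - 1 ≤ P.K₀) (hNq : P.Nq = P.K)
    (hθ : (1 / 2 : ℝ) ≤ P.θ₀) (hAmax : P.Amax ≤ 2 ^ n * P.Ω) (hA1 : ∀ j, 1 ≤ P.A j) (p : ℕ) :
    RecordOdd (fun m => (256 : ℝ) ^ m) p n P.A P.Amax P.W P.D0N P.S0NV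
      (2 ^ n * P.XsV P.SdN / (2 * (n + 1))) P.DN :=
  P.recordOddN (P.pow_g_le_K hp3 hK₀) hNq hθ hAmax hA1 p P.one_le_D0N le_rfl le_rfl
    P.XsV_SdN_le_two_mul_add_one P.one_le_DN (fun _ => le_rfl)

/-- The `N`-record at the END slots with any larger cell constant `c ≥ 256` and the datum's own height bound
`Vmax ≥ Amax` (the frame's `RecordOdd (c^·) p n P.A Vmax P.W …`). [cite: Nesterenko2003, §5.2 (5.12)–(5.22)] -/
theorem recordOddN_datum (hp3 : 3 ≤ P.p) (hK₀ : (P.p : ℝ) - 1 ≤ P.K₀) (hNq : P.Nq = P.K)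
    (hθ : (1 / 2 : ℝ) ≤ P.θ₀) (hAmax : P.Amax ≤ 2 ^ n * P.Ω) (hA1 : ∀ j, 1 ≤ P.A j)
    {Vmax : ℝ} (hAmaxV : P.Amax ≤ Vmax) (hW0 : 0 ≤ P.W) (p : ℕ) {c : ℝ} (hc : 256 ≤ c) :
    RecordOdd (fun m => c ^ m) p n P.A Vmax P.W P.D0N P.S0NV (2 ^ n * P.XsV P.SdN / (2 * (n + 1))) P.DN := by
  have hrec := P.recordOddN_end hp3 hK₀ hNq hθ hAmax hA1 p
  have h256 := GenThreeFrameSpecOdd.recordOdd_mono_base (by norm_num : (1 : ℝ) ≤ 256) hc hA1 hW0 P.hAmax1 hrec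
  exact GenThreeFrameSpecOdd.recordOdd_mono_Vmax (fun r => by positivity) P.hn hA1 hW0 P.hAmax1 hAmaxV h256

end PadicG3ParN

end Summit.ABC.StewartYu
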